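import Mathlib.Analysis.SpecialFunctions.Pow.Real
import Literature.Computability.AlgebraicComplexity.ValiantClasses
import Literature.Computability.AlgebraicComplexity.StandardFamilies
import HarnessLib

/-!
# Barrier catalogue `ValiantsHypothesis`: the monotone gap — `VP` contains families of
exponential monotone complexity (Valiant 1980; Jerrum–Snir 1982;
Chattopadhyay–Datta–Ghosal–Mukhopadhyay 2022), so monotone lower bounds do not transfer

D-0021 barrier entry for the summit `ValiantsHypothesis` (`VP_ℂ ≠ VNP_ℂ`). Technique class:
*monotone lower bounds* — bounds on the size of arithmetic circuits over the semiring
`(ℝ₊, +, ×)` (no subtraction, no negative constants), for which exponential lower bounds for the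
permanent ARE known (Jerrum–Snir 1982, §4.3: exactly `n(2^{n-1} - 1)` multiplications), read as
evidence of, or as a route to, super-polynomial GENERAL circuit complexity. The barrier: the
inference "exponential monotone complexity ⇒ not in `VP`" is refuted by explicit `VP` families of
exponential monotone complexity (Valiant 1980, perfect matchings of planar grids; Jerrum–Snir
1982, directed spanning trees; strongly exponential since CDGM 2022), and the refined
`ε`-sensitive version of the inference (Hrubeš 2020) is refuted in the range `ε ≥ 2^{-Ω(n)}`
by the same `VP` family (CDGM 2022).

**The printed results** (all checked with `lit read`; page/section locators below).

* Valiant, TCS 12 (1980) (held scan `paper:doi-10-1016-0304-3975-80-90060-2`, text layer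
  partially legible), §3: for the triangular grid graphs `G_n` and their perfect matching
  polynomial `P_G = Σ_{matchings} Π x_e`, Thm. 1: "There is a constant `c > 1` such that" every
  monotone program for `P_{G_n}` has complexity at least `c^n`; Thm. 2 (p. 11 of the scan): "There
  is a constant `k` such that for any field `F` of characteristic zero if `G = G_n` then there is a
  program for `P_G` of complexity `O(n^k)`" (proof: Kasteleyn's Pfaffian orientation,
  `P_G = √det(A_G)`, Strassen). §2, Lemma 3: over `ℝ` or `ℚ`, "`P = Q - R` for some monotone
  `Q` and `R` that can be computed simultaneously by a monotone program of complexity `6c`".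
* Jerrum–Snir, J. ACM 29 (1982) 874–897 (held). §2.1–2.2 (pp. 876–877): semirings, among them
  "the semiring of nonnegative real numbers with the usual addition and multiplication
  `R = (ℝ⁺, +, ·, 0, 1)`"; a computation is a dag whose input nodes are labelled by elements of
  `S ∪ X` (constants and indeterminates) and whose internal nodes "all have indegree 2 and are
  labeled either by `⊕` or `⊗`"; "The `⊗`-complexity of `Γ` is simply the number of `⊗`-nodes
  of `Γ`." Cor. 2.3 (p. 878): over `R` the `⊗`-complexity of a polynomial equals that of the
  polynomial function it represents. §4.3 (pp. 887–889): for the permanent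
  `per_{n×n}(X) = Σ_{π ∈ S(n)} x_{1,π(1)} ⋯ x_{n,π(n)}`, "`⊗`-complexity of `p ≥ n(2^{n-1} - 1)`.
  This lower bound is in fact attained by the permanental equivalent of Laplace's expansion
  rule", "the lower bound is valid for `R`, `M`, and `M⁺`". §4.5 (pp. 891–892): the spanning tree
  polynomial `ST_{n×n} = Σ_{t ∈ T(n)} x_{2,t(2)} x_{3,t(3)} ⋯ x_{n,t(n)}`,
  `T(n) = {t : {2,…,n} → {1,…,n} | ∀ i ∃ k, t^k(i) = 1}` ("monomials correspond to directed
  trees spanning `K_n` and rooted at node 1"); "in this case we are unable to obtain a precise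
  lower bound. We therefore content ourselves with a crude bound on the content of a node, which,
  however, is good enough to yield an exponential lower bound on the `⊗`-complexity of
  `ST_{n×n}`", "an exponential bound valid for `R`, `M`, and `M⁺`" (the explicit form, §5.1
  p. 893, reads `n^{-1}(4/3)^{n-1}` as far as the scan is legible; only the exponential form is
  vendored). §5.1 "The power of negation" (p. 893): "our results indicate an exponential gap for
  the spanning tree polynomial ... if negative constants are allowed, the same polynomial can be
  expressed as an `n × n` determinant whose elements are linear combinations of the
  indeterminates [13], and this determinant can then be evaluated (without divisions) in
  `O(n^{3.52})` multiplications using the method of Strassen"; for the permanent "a very modest gain": `n(2^{n-1} - 1)`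
  monotone versus `(n-1)2^{n-1} + 3` with subtraction (Ryser), "the only one we know for a 0-1
  polynomial which is complete in the sense of [26]".
* Chattopadhyay–Datta–Ghosal–Mukhopadhyay, ITCS 2022 (arXiv:2109.06941, held), abstract and
  §1: "Jerrum and Snir [JS82] ... showed that the spanning tree polynomial, defined over complete
  graphs with `n` vertices (so the number of variables is `n²`), has monotone complexity
  `2^{Ω(n)}`"; "In both these works [Val79, JS82], the monotone polynomials were respectively
  exhibited on `n` variables, shown to be computed by general arithmetic circuits of polynomial in
  `n` size, and were also shown to require monotone circuits of size `2^{Ω(√n)}`"; "It is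
  well-known that for every `G`, `ST_n(G̃)` can be computed even by an algebraic branching program
  of size `poly(n)` [Moon70] via a determinant computation [MV97]" (§1, p. 4). First main theorem
  (§1, "Details of Our Results"; proved in §3): for `d`-regular expanders `G` with
  `λ₂ ≤ d^{1-ε}`, "every monotone circuit for `ST_n(G̃)` must be of size at least `2^{Ω(n)}`" —
  "the first strongly exponential lower bound on monotone arithmetic circuit complexity for a
  polynomial in VP" (abstract); "This left the following possibility open in principle: proving a
  strongly exponential lower bound of `2^{Ω(n)}` on the monotone complexity of a monotone
  polynomial was enough to show that it did not admit general circuits of polynomial size. Our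
  first result finally rules out this possibility" (§1). Second main theorem (§1):
  "There exists a constant `η > 0` such that both the polynomials `F_{n-1,n} - ε·ST_n` and
  `F_{n-1,n} + ε·ST_n` have monotone circuit complexity `2^{Ω(n)}` provided `ε ≥ 2^{-ηn}`, where
  `ST_n` is the spanning tree polynomial defined over the complete graph of `n` vertices" and
  `F_{n-1,n} := Π_{i=2}^n (x_{i,1} + ⋯ + x_{i,n})` — "the first `ε`-sensitive exponential lower
  bound for a family of polynomials inside VP" (abstract). §1 on Hrubeš's programme [H20]: "if a
  polynomial `f_n` of degree `d` over `n` variables ... is computed efficiently by a circuit, with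
  access to negations, of size `s`, then there exists `ε₀ > 0`, such that for every `ε ≤ ε₀`, the
  function `F_n + ε·f_n` has efficient monotone circuits, where `F_n := (1+x₁+⋯+x_n)^d`";
  "Hrubeš' argument yields `ε` to be as small as doubly exponentially small to rule out `s`-size
  general circuits. Is that necessary? Or the kind of `ε` that [CDM21] handles is (nearly)
  sufficient? We give a strong evidence against the latter".
* Bürgisser, *Completeness classes in algebraic complexity theory* (arXiv:2406.06217), §5.1
  "Monotone circuits": "Valiant [vali:80-1] proved an exponential lower bound for monotone
  arithmetic circuits computing perfect matching polynomials for planar graphs, thus rigorously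
  showing that an exponential gain is possible when allowing subtractions. ... Jerrum and Snir even
  showed that the complexity of prominent functions like the permanent and iterated matrix
  multiplication can be exactly determined in the monotone model of computation. So monotone
  computations are too restrictive to be of interest for computational complexity."

**Further printed results read for the barrier audit of 2026-08-16** (scope of the technique
class; all page-level, `lit read`).

* Chattopadhyay–Datta–Mukhopadhyay, STOC 2021 (held as `paper:galaxy-pdf-6569535347425970800`),
  Thm. 1.1: "For every constant `0 < δ < 1`, there exists a `δ`-non-sink polynomial `P_{δ,n,m}`
  that has a depth-three arithmetic formula of size `O_δ(nm⁴)`" and "every `δ`-non-sink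
  polynomial `Q_{δ,n,m}` needs monotone circuits (with no depth restrictions) of size `2^{Ω(√m)}`
  to be computed, when `4m ln m ≤ n`" — a `ΣΠΣ` (hence `VF`) family with nonnegative
  coefficients and exponential monotone complexity.
* Cavalar–Borém Fabris–Mukhopadhyay–Srinivasan–Yehudayoff (arXiv:2512.19515, Dec. 2025, held),
  Thm. 1.1: "There is an `n`-variate polynomial `P = P_n` such that the following hold: `P` can
  be computed by a `ΣΠΣ` circuit of size `O(n³)`. Any monotone arithmetic circuit computing `P`
  has size at least `2^{Ω(n)}`", "the strongest possible separation between monotone and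
  non-monotone computation in the algebraic setting. A single negation gate which performs the
  subtraction of two monotone depth three circuits is exponentially powerful even compared to
  general monotone circuits" (§1.1); on the division problem of [HY21]: "proving that there are
  explicit monotone polynomials `P` such that for every monotone polynomial `Q`, the monotone
  complexity of `P · Q` is high [HY21]. All of our proof techniques seem to fail for this
  problem" (§1.1); and (§1.1, before Thm. 1.4) "the known lower bounds for the perfect bipartite
  matching function already imply that any power of the permanent polynomial is
  superpolynomially [Raz85] (and even exponentially [CGRSS25]) hard for monotone arithmetic
  circuits".
* Fomin–Grigoriev–Koshevoy, FoCM 16 (2016) (arXiv:1307.8425, held), §1: subtraction-free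
  complexity is `{+,×,÷}`-complexity; Ex. 1.6: "the generating function for directed spanning
  trees in a complete directed graph on `n` vertices has `poly(n)` subtraction-free complexity.
  This contrasts with an exponential lower bound for the `{+,*}`-complexity of the same generating
  function, given by M. Jerrum and M. Snir" (proved in §7 by star–mesh transformations);
  Rem. 1.5, on Valiant's triangular-grid matchings: "`{+,-,*,/}`-complexity `<`
  `{+,*,/}`-complexity `<` `{+,*}`-complexity, at least one of the two steps must give a jump from
  `poly(n)` to a superpolynomial growth rate. Either of these two conclusions would be exciting
  to make; we just don't know which one is true"; Ex. 1.4 and §8 (Prop. 8.5–8.6): the printed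
  exponential gap between ordinary and `{+,×,÷}`-complexity is for `x² - 2(1 - 2^{-2^n})x + 1`
  and a degree-4 `g_n = (1-x₁)² + (x₁-2x₂)² + (x₂²-x₃)² + ⋯ + 4x_n²x₁` — polynomials WITH
  negative coefficients, positive only as functions ("this example is somewhat artificial").
* Hrubeš–Yehudayoff, *Shadows of Newton polytopes*, CCC 2021 (LIPIcs 200:9, fetched), §1
  Thm. 1 ("Every monotone formula computing `f` contains at least `σ(Newt(f))` leaves"), Thm. 2
  (transparent `f`: monotone circuits of size `Ω(σ(Newt(f)))`), "Any non-trivial connection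
  between the arithmetic complexity of `f` and some geometric complexity measure of `Newt(f)`,
  such as shadow complexity, will be an exciting development. We exhibit such a connection in
  the case of monotone computations"; §6 "Divisions": "If `f` can be computed by a monotone
  circuit with divisions of size `s` then we can find non-zero `h` and `g` with monotone circuit
  size `O(s)` such that `fh = g`", "Super-polynomial lower bounds on monotone circuits with
  division computing a monotone polynomial `f` are not known", Problem 2 = §9 Open Problem 3:
  "Find an explicit monotone `f_n` (with polynomially many variables and of a polynomial degree)
  such that `g` requires superpolynomial monotone arithmetic circuit whenever `g ≠ 0` and `f_n`
  divides `g`"; Thm. 42–44 (partial answers for monotone FORMULAS with division), Rem. 45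
  ("Transparency is fragile").
* Hrubeš, ECCC TR19-034 = Comput. Complexity 29 (2020) (now held as
  `paper:galaxy-pdf-8480837716326541740`; Thm. 1 is vendored in
  `Literature/Computability/AlgebraicComplexity/HrubesSensitiveMonotone.lean`): §4, Lemma 22 and
  the proof of Thm. 1 — `R_u = c` at a constant leaf `c`, `R_u = 1` at a variable,
  `R_{u+v} = R_u + R_v`, `R_{uv} = R_u R_v`, and `ε₀ = R⁻¹` with `R = Σ_k R_k` over the
  homogeneous parts of the negative part `f₋` of a one-subtraction form `f = f₊ - f₋` (Lemma 23):
  `ε₀` is "doubly exponentially small" in `s` (CDGM §1) only through the magnitude of the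
  constants a size-`s` circuit can build; §6 Open problem 1: "Show that
  `Π_{i=1}^n (Σ_{j=1}^n x_{i,j}) - perm_n` requires a monotone arithmetic circuit of an
  exponential size. How about `Π_{i=1}^n (Σ_{j=1}^n x_{i,j}) + perm_n`?" (the case `ε = 1`).
* CDGM once more, §1 (p. 4): with the set-multilinear universal polynomial
  `F_{n,m} = Π_i Σ_j x_{i,j}` in place of `(1 + Σ x_i)^d`, "Such monotone `ε`-sensitive lower
  bounds would then yield commensurate lower bounds on the size of set-multilinear circuits
  computing `f_n`"; §7 (open problems): "It will be very interesting to find a family of explicit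
  polynomials in VP which can be computed by polynomial-size formulas but the monotone circuit
  complexity is strongly exponential" (answered by CBFMSY 2025, above); "How sensitive is ...
  `F_{n,n} - ε·det_{n,n}`? ... this communication problem [do two half-maps form a permutation]
  shows up when one tries to prove `ε`-sensitive lower bounds for either the determinant or the
  permanent via our discrepancy-sensitivity correspondence. However, this communication problem
  has even an efficient bounded-error randomized protocol, ruling out the direct use of our
  current technique"; "Spanning tree polynomials are not known have efficient (set-)multilinear
  circuits."

**What this file does.**

1. Jerrum–Snir's model inside the tree's circuit model (`CplxAlg.ArithCircuit` over an arbitrary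
   commutative semiring): a *monotone computation* of `f ∈ ℝ≥0[X]` is a fan-in-two circuit over
   the semiring `ℝ≥0` whose sum gates are plain additions (all coefficients `1`; constants enter
   only as input operands, as in JS §2.2) computing `f` (`IsMonotoneComputation`); its
   `⊗`-complexity is its number of product gates (`prodCount`). A JS computation dag is literally
   such a circuit (`⊗`-nodes ↦ binary product gates, `⊕`-nodes ↦ `sum [(1,u),(1,v)]`, inputs ↦
   operands) with the same number of product gates, and conversely such a circuit becomes a JS
   dag with at most `prodCount` `⊗`-nodes (product gates of fan-in `< 2` compute `1` or copy an
   operand, sum gates of fan-in `< 2` are `0` or a copy, junk references are the input `0`), so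
   lower bounds on JS's `⊗`-complexity are exactly lower bounds on `prodCount` over monotone
   computations, and `prodCount ≤ size` (`prodCount_le_size`).
2. The spanning tree polynomial `stPoly R N` (JS §4.5 with `n = N + 1` nodes, the root being
   `none : Option (Fin N)` and the non-root nodes `Fin N`; variables `x_{i,j}`, `i` non-root, `j`
   any node; `IsArborescence t`: iterating the parent map from every node reaches the root), over
   any commutative semiring, with `map_stPoly` (its coefficients are `0, 1`) and homogeneity of
   degree `N`.
3. Named facts (D-0014): `JerrumSnir1982_permanent` (§4.3, exact monotone `⊗`-complexity of
   `per_n`), `JerrumSnir1982_spanningTree` (§4.5, in the exponential form printed there and in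
   CDGM §1), `isVPFamily_stPoly` (JS §5.1, CDGM §1: `ST ∈ VP`, over every field), and
   `CDGM2022_sensitive` (second main theorem, for the plain circuits of item 1, which are among
   the monotone circuits of the source, in the range `2^{-ηN} ≤ ε < 1` where `F - ε·ST` has
   nonnegative coefficients).
4. The technique class `MonotoneLowerBoundsTransfer` — "a p-family over `ℝ≥0` whose monotone
   circuits have size `2^{Ω(n)}` is not in `VP_ℝ`" — which WOULD yield `per ∉ VP_ℝ` from JS §4.3
   (`MonotoneLowerBoundsTransfer.per_not_isVPFamily`, proved), and its refutation from the
   barrier fact `MonotoneGap := JerrumSnir1982_spanningTree ∧ isVPFamily_stPoly`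
   (`MonotoneGap.not_monotoneLowerBoundsTransfer`, proved); likewise the `ε`-sensitive transfer at
   rate `2^{-ηn}` (`SensitiveTransfer η`) is refuted for some `η > 0` from `CDGM2022_sensitive` and
   `isVPFamily_stPoly` (`not_sensitiveTransfer`, proved).
5. (Barrier audit, 2026-08-16.) The neighbouring technique class that this entry does NOT refute,
   stated so that routes and refuters can point at it: `DivisionLowerBoundsTransfer` — lower
   bounds for subtraction-free circuits WITH DIVISION, in the Hrubeš–Yehudayoff normal form
   `f · h = g` with `g, h ≠ 0` monotone (HY21 §6: one division at the end), read as `VP` lower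
   bounds. Division-hardness with `h = 1` is plain monotone hardness, so the division transfer is
   IMPLIED by `MonotoneLowerBoundsTransfer` (`MonotoneLowerBoundsTransfer.divisionLowerBoundsTransfer`,
   proved; `isMonotoneComputation_ofConst`: the constant `1` costs no gate): it is the weaker
   principle, and refuting it needs a `VP` family that stays hard when a monotone cofactor `h` is
   allowed. No such family is known — the witnesses of this entry are division-EASY (`ST`: FGK
   Ex. 1.6/§7, and in the tree the closed items `StDivisionEasy`, `SensitiveStDivisionEasy`,
   `SquareGridDimersDivisionEasy` of the route `Summits/ValiantsHypothesis/ValiantsHypothesis/Theses/DivisionGap.lean`,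
   proved in `…/Theorems/DivisionGapStDivisionEasy.lean` (`stDivisionEasy_proof`),
   `…/Theorems/DivisionGapSensitiveStDivisionEasy.lean` (`sensitiveStDivisionEasy_proof`) and
   `…/Theorems/DivisionGapSquareGridDimersDivisionEasy*.lean`; Literature cannot import them),
   Valiant's triangular-grid matchings are open (FGK Rem. 1.5), and no explicit monotone
   polynomial whatsoever is known to be division-hard (HY21 §6 and Open Problem 3; CBFMSY 2025
   §1.1: "All of our proof techniques seem to fail for this problem").

## References

* [Valiant1980] L. G. Valiant, *Negation can be exponentially powerful*, TCS 12 (1980) 303–314,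
  §2 Lemma 3, §3 Thm. 1, Thm. 2.
* [JerrumSnir1982] M. Jerrum, M. Snir, *Some exact complexity results for straight-line
  computations over semirings*, J. ACM 29 (1982) 874–897, §2.1–2.2, Cor. 2.3, Cor. 3.5, §4.3,
  §4.5, §5.1.
* [ChattopadhyayDattaGhosalMukhopadhyay2022] A. Chattopadhyay, R. Datta, U. Ghosal,
  P. Mukhopadhyay, *Monotone complexity of spanning tree polynomial re-visited*, ITCS 2022
  (arXiv:2109.06941), abstract, §1 (both main theorems, the discussion of [Val79], [JS82], [H20],
  [CDM21]), §2 (Thm. 2.1), §3, concluding open problems.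
* [Hrubes2020] P. Hrubeš, *On ε-sensitive monotone computations*, Comput. Complexity 29 (2020) 6;
  ECCC TR19-034 (held), Thm. 1, §4 (Lemmas 22–23), §6 Open problem 1.
* [ChattopadhyayDattaMukhopadhyay2021] A. Chattopadhyay, R. Datta, P. Mukhopadhyay, *Lower bounds
  for monotone arithmetic circuits via communication complexity*, STOC 2021, Thm. 1.1 (depth-three
  formulas versus monotone circuits), Thm. 1.2 (the first `ε`-sensitive bound, for a `VNP`
  family).
* [CavalarBoremFabrisMukhopadhyaySrinivasanYehudayoff2025] B. Cavalar, T. Borém Fabris,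
  P. Mukhopadhyay, S. Srinivasan, A. Yehudayoff, *Negations are powerful even in small depth*,
  arXiv:2512.19515 (2025), §1.1, Thm. 1.1, Thm. 1.2, Thm. 1.4.
* [FominGrigorievKoshevoy2014] S. Fomin, D. Grigoriev, G. Koshevoy, *Subtraction-free complexity,
  cluster transformations, and spanning trees*, Found. Comput. Math. 16 (2016) 1–31
  (arXiv:1307.8425), §1 Ex. 1.4–1.6, Rem. 1.5, §7, §8 (Prop. 8.5–8.6).
* [HrubesYehudayoff2021] P. Hrubeš, A. Yehudayoff, *Shadows of Newton polytopes*, CCC 2021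
  (LIPIcs 200) 9:1–9:23, §1 (Thm. 1–2, Rem. 3), §6 (Problem 2, Thm. 42–44, Rem. 45–46), §9 (Open
  Problem 3).
* [Burgisser2024Completeness] P. Bürgisser, arXiv:2406.06217, §5.1.
-/

noncomputable section

namespace Literature.Barriers.ValiantsHypothesis

open Literature.Computability.AlgebraicComplexity MvPolynomial
open scoped NNReal

universe u v

/-! ### Jerrum–Snir's monotone model inside `CplxAlg.ArithCircuit` -/

section Model

variable {k : Type u} {σ : Type v}

/-- A gate is *plain* if it is a product gate or a sum gate all of whose coefficients are `1`
(a plain addition): the internal nodes of a Jerrum–Snir computation are binary `⊕`- and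
`⊗`-nodes, constants entering only as inputs. [cite: JerrumSnir1982, §2.2] -/
def IsPlainGate [One k] : ArithCircuit.Gate k σ → Prop
  | .sum args => ∀ a ∈ args, a.1 = 1
  | .prod _ => True

/-- A circuit is *plain* if all its gates are. [cite: JerrumSnir1982, §2.2] -/
def IsPlain [One k] (P : ArithCircuit k σ) : Prop :=
  ∀ g ∈ P.gates, IsPlainGate g

/-- Indicator of product gates. [cite: JerrumSnir1982, §2.2] -/
def isProdGate : ArithCircuit.Gate k σ → Bool
  | .prod _ => true
  | .sum _ => false

/-- The number of product gates of a circuit — Jerrum–Snir's `⊗`-complexity of a computation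
("simply the number of `⊗`-nodes"). [cite: JerrumSnir1982, §2.2] -/
def prodCount (P : ArithCircuit k σ) : ℕ :=
  P.gates.countP fun g => isProdGate g

/-- The `⊗`-count is at most the size (number of gates). [cite: JerrumSnir1982, §2.2] -/
theorem prodCount_le_size (P : ArithCircuit k σ) : prodCount P ≤ P.size :=
  List.countP_le_length

/-- Product gates are plain. [folklore] -/
@[simp] theorem isPlainGate_prod [One k] (args : List (ArithCircuit.Operand k σ)) :
    IsPlainGate (ArithCircuit.Gate.prod args) := trivial

/-- A sum gate is plain iff all its coefficients are `1`. [folklore] -/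
theorem isPlainGate_sum_iff [One k] (args : List (k × ArithCircuit.Operand k σ)) :
    IsPlainGate (ArithCircuit.Gate.sum args) ↔ ∀ a ∈ args, a.1 = 1 := Iff.rfl

/-- A *monotone computation* of a polynomial `f` with nonnegative real coefficients, in the sense
of Jerrum–Snir: a plain fan-in-two circuit over the semiring `R = (ℝ≥0, +, ·, 0, 1)` ("the
semiring of nonnegative real numbers with the usual addition and multiplication") computing `f`
as a formal polynomial (over `R` this is the same as computing the polynomial function,
Cor. 2.3). Valiant's monotone programs (`+`, `×`, positive constants) and the monotone circuits
of CDGM (no negative constants) contain these. [cite: JerrumSnir1982, §2.1–2.2 and Cor. 2.3] -/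
def IsMonotoneComputation (P : ArithCircuit ℝ≥0 σ) (f : MvPolynomial σ ℝ≥0) : Prop :=
  P.IsFanInTwo ∧ IsPlain P ∧ P.Computes f

/-- The gate-free circuit reading off a variable is a monotone computation of that variable with
no product gate (non-vacuity of the model). [folklore] -/
theorem isMonotoneComputation_ofVar (i : σ) :
    IsMonotoneComputation (ArithCircuit.ofVar i : ArithCircuit ℝ≥0 σ) (X i) ∧
      prodCount (ArithCircuit.ofVar i : ArithCircuit ℝ≥0 σ) = 0 := by
  refine ⟨⟨?_, ?_, ArithCircuit.eval_ofVar i⟩, rfl⟩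
  · intro g hg; simp [ArithCircuit.ofVar] at hg
  · intro g hg; simp [ArithCircuit.ofVar] at hg

end Model

/-! ### The directed spanning tree polynomial of the complete graph (Jerrum–Snir §4.5) -/

section SpanningTree

variable {N : ℕ}

/-- The parent map of `t`: the root `none` is fixed, the non-root node `i` goes to `t i`.
[cite: JerrumSnir1982, §4.5] -/
def parentMap (t : Fin N → Option (Fin N)) : Option (Fin N) → Option (Fin N) :=
  fun v => v.bind t

/-- The root is fixed by the parent map. [folklore] -/
@[simp] theorem parentMap_none (t : Fin N → Option (Fin N)) : parentMap t none = none := rfl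

/-- The parent of the non-root node `i` is `t i`. [folklore] -/
@[simp] theorem parentMap_some (t : Fin N → Option (Fin N)) (i : Fin N) :
    parentMap t (some i) = t i := rfl

/-- `t` is an arborescence (a directed spanning tree of the complete graph on the nodes
`Option (Fin N)`, rooted at `none`, edges towards the root): from every node, iterating the
parent map reaches the root — Jerrum–Snir's `T(n) = {t : {2,…,n} → {1,…,n} | ∀ i ∃ k, t^k(i) = 1}`
with `n = N + 1`, root `1 ↦ none`. [cite: JerrumSnir1982, §4.5] -/
def IsArborescence (t : Fin N → Option (Fin N)) : Prop :=
  ∀ i : Fin N, ∃ r : ℕ, (parentMap t)^[r] (some i) = none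

/-- The star (every node attached to the root) is an arborescence. [folklore] -/
theorem isArborescence_star : IsArborescence (fun _ : Fin N => (none : Option (Fin N))) :=
  fun _ => ⟨1, rfl⟩

/-- A map with a fixed point `t i = some i` (a loop) is not an arborescence. [folklore] -/
theorem not_isArborescence_of_loop {t : Fin N → Option (Fin N)} {i : Fin N} (h : t i = some i) :
    ¬ IsArborescence t := by
  intro ht
  obtain ⟨r, hr⟩ := ht i
  have : ∀ r : ℕ, (parentMap t)^[r] (some i) = some i := by
    intro r
    induction r with
    | zero => rfl
    | succ r ih => rw [Function.iterate_succ_apply, parentMap_some, h, ih]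
  rw [this] at hr
  exact Option.some_ne_none _ hr

open Classical in
/-- **The spanning tree polynomial** `ST` of Jerrum–Snir over a commutative semiring `R`:
`stPoly R N = Σ_{t arborescence} Π_{i : Fin N} x_{i, t(i)}` in the variables `x_{i,j}`,
`i ∈ Fin N` (non-root nodes), `j ∈ Option (Fin N)` (all `N + 1` nodes) — JS's `ST_{n×n}` for
`n = N + 1` ("monomials correspond to directed trees spanning `K_n` and rooted at node 1"; the
variables `x_{1,j}` of JS's `n × n` matrix do not occur in `ST_{n×n}` and are omitted), CDGM's
`ST_n` for the complete graph. [cite: JerrumSnir1982, §4.5] -/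
def stPoly (R : Type u) [CommSemiring R] (N : ℕ) : MvPolynomial (Fin N × Option (Fin N)) R :=
  ∑ t ∈ (Finset.univ : Finset (Fin N → Option (Fin N))).filter IsArborescence,
    ∏ i : Fin N, X (i, t i)

/-- `ST` has coefficients `0, 1`: it is compatible with every change of scalars, in particular
`map NNReal.toRealHom (stPoly ℝ≥0 N) = stPoly ℝ N`. [cite: JerrumSnir1982, §2.2 (the map τ)] -/
theorem map_stPoly {R S : Type u} [CommSemiring R] [CommSemiring S] (φ : R →+* S) (N : ℕ) :
    map φ (stPoly R N) = stPoly S N := by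
  classical
  simp only [stPoly, _root_.map_sum, _root_.map_prod, map_X]

/-- `ST` is homogeneous of degree `N` (one edge out of every non-root node).
[cite: JerrumSnir1982, §4.5] -/
theorem stPoly_isHomogeneous (R : Type u) [CommSemiring R] (N : ℕ) :
    (stPoly R N).IsHomogeneous N := by
  classical
  unfold stPoly
  refine IsHomogeneous.sum _ _ _ fun t _ => ?_
  have h := IsHomogeneous.prod (Finset.univ : Finset (Fin N))
    (fun i => (X (i, t i) : MvPolynomial (Fin N × Option (Fin N)) R)) (fun _ => 1)
    (fun i _ => isHomogeneous_X R (i, t i))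
  simpa using h

/-- Hence `deg ST ≤ N`. [cite: JerrumSnir1982, §4.5] -/
theorem totalDegree_stPoly_le (R : Type u) [CommSemiring R] (N : ℕ) :
    (stPoly R N).totalDegree ≤ N :=
  (stPoly_isHomogeneous R N).totalDegree_le

open Classical in
/-- CDGM's perturbed full set-multilinear polynomials `F_{n-1,n} ∓ ε·ST_n` over `ℝ≥0`, `n = N+1`:
`F_{n-1,n} = Π_{i non-root} Σ_{j} x_{i,j} = Σ_{t : Fin N → Option (Fin N)} Π_i x_{i,t(i)}`, so the
coefficient of the monomial of `t` is `1 - ε` (`sub = true`; this is the real number `1 - ε`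
for `ε ≤ 1`) resp. `1 + ε` (`sub = false`) if `t` is an arborescence and `1` otherwise.
[cite: ChattopadhyayDattaGhosalMukhopadhyay2022, §1 (second main theorem)] -/
def sensitiveSTPoly (N : ℕ) (ε : ℝ≥0) (sub : Bool) : MvPolynomial (Fin N × Option (Fin N)) ℝ≥0 :=
  ∑ t : Fin N → Option (Fin N),
    (if IsArborescence t then (if sub then 1 - ε else 1 + ε) else 1) • ∏ i : Fin N, X (i, t i)

end SpanningTree

/-! ### The printed results as named facts (D-0014) -/

/-- **Jerrum–Snir 1982, §4.3: the monotone `⊗`-complexity of the permanent is exactly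
`n(2^{n-1} - 1)`.** "`⊗`-complexity of `p ≥ n!/(n-1)! · (2^{n-1} - 1) = n(2^{n-1} - 1)`. This
lower bound is in fact attained by the permanental equivalent of Laplace's expansion rule"; "the
lower bound is valid for `R`, `M`, and `M⁺`". Rendered for `R = ℝ≥0` in the model of this file
(every monotone computation of `per_n` has at least, and some has exactly, `n(2^{n-1} - 1)`
product gates), `n ≥ 1`. [cite: JerrumSnir1982, §4.3] -/
def JerrumSnir1982_permanent : Prop :=
  ∀ n : ℕ, 1 ≤ n →
    (∀ P : ArithCircuit ℝ≥0 (Fin n × Fin n), IsMonotoneComputation P (perPoly (Fin n) ℝ≥0) →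
        n * (2 ^ (n - 1) - 1) ≤ prodCount P) ∧
      ∃ P : ArithCircuit ℝ≥0 (Fin n × Fin n), IsMonotoneComputation P (perPoly (Fin n) ℝ≥0) ∧
        prodCount P = n * (2 ^ (n - 1) - 1)

/-- **Jerrum–Snir 1982, §4.5: the spanning tree polynomial has exponential monotone
`⊗`-complexity.** "a crude bound on the content of a node, which, however, is good enough to
yield an exponential lower bound on the `⊗`-complexity of `ST_{n×n}`"; "an exponential bound
valid for `R`, `M`, and `M⁺`"; in the words of CDGM §1: "the spanning tree polynomial, defined
over complete graphs with `n` vertices (so the number of variables is `n²`), has monotone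
complexity `2^{Ω(n)}`". Rendered (with `n = N + 1`, constants absorbed): there are `c > 0` and
`N₀` such that every monotone computation of `stPoly ℝ≥0 N`, `N ≥ N₀`, has at least `2^{cN}`
product gates. [cite: JerrumSnir1982, §4.5 and §5.1] -/
def JerrumSnir1982_spanningTree : Prop :=
  ∃ c : ℝ, 0 < c ∧ ∃ N₀ : ℕ, ∀ N : ℕ, N₀ ≤ N →
    ∀ P : ArithCircuit ℝ≥0 (Fin N × Option (Fin N)), IsMonotoneComputation P (stPoly ℝ≥0 N) →
      (2 : ℝ) ^ (c * N) ≤ prodCount P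

/-- **`ST ∈ VP`** (the general-circuit side of the gap): "if negative constants are allowed, the
same polynomial can be expressed as an `n × n` determinant whose elements are linear
combinations of the indeterminates" (JS §5.1, the directed matrix-tree theorem), "`ST_n(G̃)` can
be computed even by an algebraic branching program of size `poly(n)` [Moon70] via a determinant
computation [MV97]" (CDGM §1); the determinant family is in `VP` over every field
(`CplxAlg.isVPFamily_detPoly`). Rendered: over every field `F`, `(stPoly F N)_N` is a
p-computable p-family. [cite: JerrumSnir1982, §5.1] [cite: ChattopadhyayDattaGhosalMukhopadhyay2022, §1 (p. 4)] -/
def isVPFamily_stPoly : Prop :=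
  ∀ (F : Type) [Field F], IsVPFamily (k := F) fun N => stPoly F N

/-- **CDGM 2022, second main theorem (`ε`-sensitive lower bound for a `VP` family).** "There
exists a constant `η > 0` such that both the polynomials `F_{n-1,n} - ε·ST_n` and
`F_{n-1,n} + ε·ST_n` have monotone circuit complexity `2^{Ω(n)}` provided `ε ≥ 2^{-ηn}`."
Rendered for the monotone computations of this file (a subclass of the monotone circuits of the
source, so the printed bound applies), `n = N + 1` with constants absorbed, and in the range
`ε < 1` in which `F - ε·ST` has nonnegative coefficients (the source's `ε ∈ (0,1)`).
[cite: ChattopadhyayDattaGhosalMukhopadhyay2022, §1 (second main theorem)] -/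
def CDGM2022_sensitive : Prop :=
  ∃ η : ℝ, 0 < η ∧ ∃ c : ℝ, 0 < c ∧ ∃ N₀ : ℕ, ∀ N : ℕ, N₀ ≤ N → ∀ ε : ℝ≥0,
    (2 : ℝ) ^ (-(η * N)) ≤ ε → ε < 1 → ∀ sub : Bool,
      ∀ P : ArithCircuit ℝ≥0 (Fin N × Option (Fin N)),
        IsMonotoneComputation P (sensitiveSTPoly N ε sub) → (2 : ℝ) ^ (c * N) ≤ P.size

/-! ### The technique classes -/

/-- **Technique class: exponential monotone lower bounds transfer to `VP`.** For every p-family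
`(f_n)` of polynomials with nonnegative real coefficients: if every monotone computation of `f_n`
has size at least `2^{cn}` for some `c > 0` and all large `n`, then `(f_n) ∉ VP_ℝ`. This is the
"possibility open in principle" of CDGM §1 (there for strongly exponential bounds), the reading
of monotone lower bounds as general ones that Valiant's title denies; by JS §4.3 it would give
`per ∉ VP_ℝ` (`MonotoneLowerBoundsTransfer.per_not_isVPFamily`).
[cite: ChattopadhyayDattaGhosalMukhopadhyay2022, §1] [cite: Valiant1980, §3 (Thm. 1–2)] -/
def MonotoneLowerBoundsTransfer : Prop :=
  ∀ (σ : ℕ → Type) [∀ n, Fintype (σ n)] (f : ∀ n, MvPolynomial (σ n) ℝ≥0),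
    IsPFamily (k := ℝ) (fun n => map NNReal.toRealHom (f n)) →
    (∃ c : ℝ, 0 < c ∧ ∃ n₀ : ℕ, ∀ n : ℕ, n₀ ≤ n → ∀ P : ArithCircuit ℝ≥0 (σ n),
        IsMonotoneComputation P (f n) → (2 : ℝ) ^ (c * n) ≤ P.size) →
    ¬ IsVPFamily (k := ℝ) (fun n => map NNReal.toRealHom (f n))

/-- **Technique class: `ε`-sensitive monotone lower bounds at rate `2^{-ηn}` transfer to
`VP`** (Hrubeš's programme read at single-exponential sensitivity, for the concrete data of the
source): if for all large `N` and every `ε` with `2^{-ηN} ≤ ε < 1` every monotone computation of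
`F_{n-1,n} ∓ ε·ST_n` (`sensitiveSTPoly N ε sub`, `n = N + 1`) has size `≥ 2^{cN}` for some
`c > 0`, then `ST ∉ VP_ℝ`. Hrubeš's theorem gives an implication of this kind when the
hypothesis persists down to arbitrarily (for size-`s` circuits: doubly exponentially in `s`) small
`ε` — precisely: with the universal polynomial `(1 + Σ x_i)^d` it refutes general circuits, and
with the set-multilinear `F_{n,m}` used here it refutes SET-MULTILINEAR circuits (§4.1 (i) of the
source; CDGM §1, p. 4; see `scope_caveats` (a) of `MonotoneGap`); CDGM ask whether
single-exponential rates suffice ("Is that necessary? Or the kind of `ε` that [CDM21] handles is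
(nearly) sufficient?") and answer in the negative for `ST` and the general-circuit conclusion.
[cite: ChattopadhyayDattaGhosalMukhopadhyay2022, §1 (the question after [CDM21])] [cite: Hrubes2020, Thm. 1 and §4.1] -/
def SensitiveTransfer (η : ℝ) : Prop :=
  (∃ c : ℝ, 0 < c ∧ ∃ N₀ : ℕ, ∀ N : ℕ, N₀ ≤ N → ∀ ε : ℝ≥0,
      (2 : ℝ) ^ (-(η * N)) ≤ ε → ε < 1 → ∀ sub : Bool,
        ∀ P : ArithCircuit ℝ≥0 (Fin N × Option (Fin N)),
          IsMonotoneComputation P (sensitiveSTPoly N ε sub) → (2 : ℝ) ^ (c * N) ≤ P.size) →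
    ¬ IsVPFamily (k := ℝ) fun N => stPoly ℝ N

/-! ### The barrier fact and the no-go theorems -/

/-- **The monotone gap (Valiant 1980; Jerrum–Snir 1982; CDGM 2022).** The barrier fact is the
conjunction of the two vendored statements about the spanning tree family: exponential monotone
`⊗`-complexity (`JerrumSnir1982_spanningTree`) and membership in `VP` over every field
(`isVPFamily_stPoly`).

BARRIER
technique_class: monotone-lower-bounds, monotone-arithmetic-circuits, negation-free-computation, support-counting, monomial-counting, monotone-to-general-transfer, epsilon-sensitive-monotone-lower-bounds
blocks: monotone lower-bound methods — circuits over the semiring `(ℝ₊,+,×)` (no subtraction and NO DIVISION), support/monomial-counting arguments without cancellation — read as general lower bounds via the transfer "exponential monotone complexity ⇒ super-polynomial general complexity" (`MonotoneLowerBoundsTransfer`) or its `ε`-sensitive refinement at single-exponential rate `ε ≥ 2^{-Ω(n)}` (`SensitiveTransfer`); in particular deriving `per ∉ VP` (hence `ValiantsHypothesis`; over `ℝ`, `MonotoneLowerBoundsTransfer.per_not_isVPFamily`) from the known exponential monotone lower bound for the permanent, `n(2^{n-1}-1)` multiplications exactly [cite: JerrumSnir1982, §4.3] — the transfer is false (`MonotoneGap.not_monotoneLowerBoundsTransfer`)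 because `VP` contains p-families of exponential monotone complexity: perfect matchings of planar triangular grids, monotone complexity `≥ c^n`, general complexity `O(n^k)` in characteristic zero [cite: Valiant1980, §3 (Thm. 1, Thm. 2)], and the directed spanning tree polynomial of `K_n`, exponential monotone `⊗`-complexity versus an `n × n` determinant of linear forms [cite: JerrumSnir1982, §4.5 and §5.1], strongly exponential (`2^{Ω(n)}` in the number `n` of variables) for spanning trees of constant-degree expanders [cite: ChattopadhyayDattaGhosalMukhopadhyay2022, §1 (first main theorem) and §3]; and the `ε`-sensitive transfer at rate `2^{-ηn}` for some `η > 0` (`not_sensitiveTransfer`), because `F_{n-1,n} ∓ ε·ST_n` keeps monotone complexity `2^{Ω(n)}` for all `ε ≥ 2^{-ηn}` while `ST ∈ VP` [cite: ChattopadhyayDattaGhosalMukhopadhyay2022, §1 (second main theorem)]; the transfer fails at EVERY level of the general model, not only for circuits: the vendored witnesses are `VBP` families (determinants, Pfaffians), and polynomial-size depth-three (`ΣΠΣ`) formulas already compute nonnegative polynomials of monotone circuit complexity `2^{Ω(√m)}` (`nm` variables, `4m ln m ≤ n`) [cite: ChattopadhyayDattaMukhopadhyay2021, Thm. 1.1]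 and `2^{Ω(n)}` (`n` variables, size `O(n³)`) [cite: CavalarBoremFabrisMukhopadhyaySrinivasanYehudayoff2025, Thm. 1.1] (cited, not vendored), so "exponential monotone complexity ⇒ not in `VF` / not a small `ΣΠΣ` circuit" is refuted as well.
because: a monotone computation cannot cancel, so every parse tree of the circuit produces a monomial of the target with its coefficient bounded by the target's ("`a_t b_t ≤ p`" in the structure theorem: a size-`s` monotone circuit writes `p = Σ_{t ≤ s} a_t b_t` with nearly balanced ordered products) [cite: ChattopadhyayDattaGhosalMukhopadhyay2022, §2 (Thm. 2.1)], and for `per`, `ST` (and Valiant's matchings) every such balanced product covers only an exponentially small fraction of the monomials (JS's content bound `|mon(p)| · w(deg p) ≤ ⊗`-complexity [cite: JerrumSnir1982, Cor. 3.5, §4.3, §4.5]; for expanders the mixing lemma against the matrix-tree count [cite: ChattopadhyayDattaGhosalMukhopadhyay2022, §3]); general circuits escape by cancellation — `ST` is a determinant (matrix-tree theorem) and planar matchings are Pfaffians [cite: JerrumSnir1982, §5.1] [cite: Valiant1980, §3 (proof of Thm. 2)], "the efficiency of algebraic algorithms seems to rely on exploiting cancellations ... monotone computations are too restrictive to be of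 interest for computational complexity" [cite: Burgisser2024Completeness, §5.1].
evasions_known: (1) DIVISION — NOT BLOCKED by this entry: lower bounds for subtraction-free circuits WITH division, `{+,×,÷}` over `ℝ₊`, equivalently (one division at the end) a monotone cofactor `h ≠ 0` with `f·h = g`, `g` monotone [cite: HrubesYehudayoff2021, §6], read as `VP` lower bounds by the WEAKER principle `DivisionLowerBoundsTransfer` (this file; implied by `MonotoneLowerBoundsTransfer`, `MonotoneLowerBoundsTransfer.divisionLowerBoundsTransfer`), which no catalogued witness refutes — `ST` has polynomial `{+,×,÷}`-complexity by star–mesh elimination [cite: FominGrigorievKoshevoy2014, Ex. 1.6 and §7] (kernel-checked in the tree as the closed route items `StDivisionEasy`, `SensitiveStDivisionEasy` (for `F_{n-1,n} ∓ ε·ST_n`) and `SquareGridDimersDivisionEasy` of `Summits/ValiantsHypothesis/ValiantsHypothesis/Theses/DivisionGap.lean`), for Valiant's triangular-grid matchings "at least one of the two steps [`{+,-,*,/}` < `{+,*,/}` < `{+,*}`] must give a jump from `poly(n)` to a superpolynomial growth rate ... we just don't know which one is true" [cite: FominGrigorievKoshevoy2014, Rem. 1.5], the printed exponential `{+,-,×,÷}`/`{+,×,÷}`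 gaps are for polynomials with negative coefficients [cite: FominGrigorievKoshevoy2014, §8 (Prop. 8.5–8.6)], "Super-polynomial lower bounds on monotone circuits with division computing a monotone polynomial `f` are not known" [cite: HrubesYehudayoff2021, §6 (Problem 2; §9 Open Problem 3)] and "All of our proof techniques seem to fail for this problem" [cite: CavalarBoremFabrisMukhopadhyaySrinivasanYehudayoff2025, §1.1]; partial results only for monotone FORMULAS with division [cite: HrubesYehudayoff2021, §6 (Thm. 42–44)] and for POWERS (`per_n^m` is monotone-hard for every `m`, through monotone Boolean bounds for bipartite matching) [cite: CavalarBoremFabrisMukhopadhyaySrinivasanYehudayoff2025, §1.1 (before Thm. 1.4)]. (2) `ε → 0⁺` — Hrubeš's `ε`-sensitive lower bounds: if `f_n` (degree `d`, `n` variables) has general circuits of size `s` then `F_n + ε·f_n`, `F_n = (1+x₁+⋯+x_n)^d` (or the full set-multilinear polynomial for set-multilinear `f`, which then bounds SET-MULTILINEAR circuits [cite: ChattopadhyayDattaGhosalMukhopadhyay2022, §1 (p. 4)]), has small monotone circuits for all sufficiently small `ε > 0`, so monotone lower bounds for `F_n + ε·f_n` that persist for `ε` "as small as doubly exponentially small"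 in `s` — i.e. as `ε → 0⁺` — DO give general circuit lower bounds, and Hrubeš "posed the challenge of establishing such lower bounds for the Permanent polynomial" [cite: Hrubes2020, Thm. 1 and §4] [cite: ChattopadhyayDattaGhosalMukhopadhyay2022, §1]; already the instance `ε = 1`, "`Π_i(Σ_j x_{i,j}) - perm_n` requires a monotone arithmetic circuit of an exponential size. How about `Π_i(Σ_j x_{i,j}) + perm_n`?", is open [cite: Hrubes2020, §6 Open problem 1]; the first `ε`-sensitive bounds, for a `VNP` family and `ε ≥ 2^{-Ω(√n)}`, are discrepancy-based [cite: ChattopadhyayDattaMukhopadhyay2021, Thm. 1.2], and the discrepancy–sensitivity correspondence cannot be used directly for `per` or `det` (the permutation-check communication problem behind both "has even an efficient bounded-error randomized protocol") [cite: ChattopadhyayDattaGhosalMukhopadhyay2022, §7]; whether rates between `2^{-Ω(n)}` and doubly exponential can be reached for explicit `VNP` families by techniques that fail on `VP` is open ("A natural goal is to obtain strongly exponential `ε`-sensitive monotone lower bounds") [cite: ChattopadhyayDattaGhosalMukhopadhyay2022, concluding open problems].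
scope_caveats: the vendored monotone model is Jerrum–Snir's (plain binary `⊕/⊗` over `(ℝ≥0,+,·)`, constants as inputs, `⊗`-nodes counted) inside the tree's `ArithCircuit`; weighted-sum monotone circuits differ from it by constant factors in size only, and nothing is claimed about the tree's `CplxAlg.complexity` over `ℝ≥0`; JS's explicit constant for `ST_{n×n}` (`n^{-1}(4/3)^{n-1}` as far as the held scan is legible) is NOT vendored, only the printed "exponential lower bound" in the `2^{Ω(n)}` form of CDGM §1; CDGM's theorems are vendored only for the complete graph (second theorem) — the expander statement (first theorem, strongly exponential) is cited, not stated, so formally only exponential-in-`√(#variables)` gaps are recorded; the `ε`-sensitive fact is stated for `ε < 1` (nonnegative coefficients) although the print has no upper limit on `ε`; `isVPFamily_stPoly` is stated over fields (print: characteristic zero in Valiant's Thm. 2 for matchings; the determinant expression of `ST` is over `ℤ`); the transfer classes conclude about `VP_ℝ`, and `VP_ℝ`-membership of a real family is the same as `VP_ℂ`-membership of its complexification only up to the standard remark that Valiant's hypothesis depends on the characteristic alone — not formalised here. BARRIER AUDIT 2026-08-16 (no-go confirmed; technique class delimited): (a) the `ε`-sensitive no-go pairs the SET-MULTILINEAR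 universal polynomial `F_{n-1,n}` with a GENERAL-circuit conclusion (`SensitiveTransfer`), and of that pairing only the rates `η ≤ η₀`, `η₀` CDGM's constant, are refuted (`not_sensitiveTransfer_of_le`); Hrubeš's simulation underwrites a general-circuit conclusion only for universal polynomials containing ALL monomials of degree `≤ d` (`(1 + Σ x_i)^d`, `H_n^d`: "the minimum requirements being that `U` contains all monomials of degree `≤ d` and that it has a small monotone circuit") [cite: Hrubes2020, §4.1 (Lemma 24, Prop. 25)], whereas with `Π_i(x_i + 1)` / `F_{n,m}` it converts (set-)multilinear circuits and so yields SET-MULTILINEAR lower bounds [cite: Hrubes2020, §4.1 (i)] [cite: ChattopadhyayDattaGhosalMukhopadhyay2022, §1 (p. 4)]; neither underwritten reading is refuted by this entry at ANY rate — no `VP` family is known to be `(1 + Σ x_i)^d`-sensitively hard at a rate `2^{-Ω(n)}` (the discrepancy–sensitivity correspondence is set-multilinear), and `ST` is "not known [to] have efficient (set-)multilinear circuits" [cite: ChattopadhyayDattaGhosalMukhopadhyay2022, §7], so whether and where the hardness of `F_{n-1,n} ∓ ε·ST` stops as `ε → 0⁺` is open (the set-multilinear reading targets set-multilinear lower bounds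 for `per`, a different open problem, not `ValiantsHypothesis`); (b) for the universal polynomial `(1 + Σ x)^N` the `VP` witness cannot be sensitively hard to arbitrarily fast rates: `ε₀ = R⁻¹` with `R` built by `R_c = c`, `R_x = 1`, `R_{u+v} = R_u + R_v`, `R_{uv} = R_u R_v` along the negative part of a one-subtraction form [cite: Hrubes2020, §4 (Lemma 22–23 and proof of Thm. 1)], i.e. at most the absolute-value evaluation of the circuit at the all-ones point, which is `2^{N^{O(1)}}` for the integer determinant circuits of `ST` — so `(1 + Σ x)^N ∓ ε·ST` is monotone-easy below some `2^{-N^C}` (a remark, not vendored); (c) the tags `support-counting` / `monomial-counting` mean counting WITHOUT cancellation (parse trees of a monotone circuit, "`a_t b_t ≤ p`"); Newton-polytope / shadow / `τ`-conjecture arguments, which count vertices, edges or real zeros of expressions WITH cancellation, are not addressed by this entry — the shadow bounds in print are monotone-only ("We exhibit such a connection in the case of monotone computations" [cite: HrubesYehudayoff2021, §1 (Thm. 1–2, Rem. 3)]), see `Literature/Computability/AlgebraicComplexity/NewtonPolygonTau.lean` for the conjectural general-circuit versions; (d) `DivisionLowerBoundsTransfer` is stated, like `MonotoneLowerBoundsTransfer`,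 for Jerrum–Snir plain circuits over `ℝ≥0`, sizes `P.size + Q.size` and `VP_ℝ`; the route `DivisionGap` phrases division complexity with the weighted-sum `complexity` over `ℝ≥0` (constant factors) and `VP_ℂ`, and restricts its transfer to `0/1`-coefficient families at quasi-polynomial rate — those choices are the route's, not this entry's.
status: theorem (established) [cite: JerrumSnir1982, §4.5 and §5.1] [cite: Valiant1980, Thm. 1–2] [cite: ChattopadhyayDattaGhosalMukhopadhyay2022, §1] -/
def MonotoneGap : Prop :=
  JerrumSnir1982_spanningTree ∧ isVPFamily_stPoly

/-- Unfolding of the barrier fact. [folklore] -/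
theorem monotoneGap_iff : MonotoneGap ↔ JerrumSnir1982_spanningTree ∧ isVPFamily_stPoly :=
  Iff.rfl

/-- Arithmetic: `2^{n/2} ≤ n(2^{n-1} - 1)` for `n ≥ 2` (the permanent's monotone bound is
exponential). [folklore] -/
theorem two_rpow_half_le_per_bound {n : ℕ} (hn : 2 ≤ n) :
    (2 : ℝ) ^ ((1 / 2 : ℝ) * n) ≤ (n * (2 ^ (n - 1) - 1) : ℕ) := by
  have h1 : (2 : ℝ) ^ ((1 / 2 : ℝ) * n) ≤ (2 : ℝ) ^ ((n - 1 : ℕ) : ℝ) := by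
    apply Real.rpow_le_rpow_of_exponent_le (by norm_num)
    have : ((n - 1 : ℕ) : ℝ) = (n : ℝ) - 1 := by
      rw [Nat.cast_sub (by omega)]; simp
    rw [this]
    have hn' : (2 : ℝ) ≤ n := by exact_mod_cast hn
    linarith
  have h2 : (2 : ℝ) ^ ((n - 1 : ℕ) : ℝ) = ((2 ^ (n - 1) : ℕ) : ℝ) := by
    rw [Real.rpow_natCast]; push_cast; ring
  have h3 : 2 ^ (n - 1) ≤ n * (2 ^ (n - 1) - 1) := by
    have h4 : 2 ≤ 2 ^ (n - 1) := by
      calc 2 = 2 ^ 1 := by norm_num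
        _ ≤ 2 ^ (n - 1) := Nat.pow_le_pow_right (by norm_num) (by omega)
    calc 2 ^ (n - 1) ≤ 2 * (2 ^ (n - 1) - 1) := by omega
      _ ≤ n * (2 ^ (n - 1) - 1) := Nat.mul_le_mul_right _ hn
  calc (2 : ℝ) ^ ((1 / 2 : ℝ) * n) ≤ ((2 ^ (n - 1) : ℕ) : ℝ) := h1.trans_eq h2
    _ ≤ (n * (2 ^ (n - 1) - 1) : ℕ) := by exact_mod_cast h3

/-- **What the technique class would give.** From Jerrum–Snir's monotone lower bound for the
permanent, the transfer would prove that the permanent family is not in `VP_ℝ` (the real form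
of `ValiantsHypothesis`). [cite: JerrumSnir1982, §4.3 and §5.1] -/
theorem MonotoneLowerBoundsTransfer.per_not_isVPFamily (h : MonotoneLowerBoundsTransfer)
    (hper : JerrumSnir1982_permanent) :
    ¬ IsVPFamily (k := ℝ) fun n => perPoly (Fin n) ℝ := by
  intro hvp
  have hmap : (fun n => map NNReal.toRealHom (perPoly (Fin n) ℝ≥0)) =
      fun n => perPoly (Fin n) ℝ := by
    funext n; exact map_perPoly _
  refine h (fun n => Fin n × Fin n) (fun n => perPoly (Fin n) ℝ≥0) ?_ ?_ (hmap ▸ hvp)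
  · rw [hmap]; exact hvp.1
  · refine ⟨1 / 2, by norm_num, 2, fun n hn P hP => ?_⟩
    calc (2 : ℝ) ^ ((1 / 2 : ℝ) * n) ≤ (n * (2 ^ (n - 1) - 1) : ℕ) := two_rpow_half_le_per_bound hn
      _ ≤ (prodCount P : ℝ) := by exact_mod_cast (hper n (by omega)).1 P hP
      _ ≤ (P.size : ℝ) := by exact_mod_cast prodCount_le_size P

/-- **The no-go theorem.** The transfer is false: the spanning tree family is a p-family over `ℝ`
(it is in `VP_ℝ`), its monotone computations have exponentially many product gates, hence
exponential size, and yet it is in `VP_ℝ`. [cite: JerrumSnir1982, §4.5 and §5.1] [cite: ChattopadhyayDattaGhosalMukhopadhyay2022, §1] -/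
theorem MonotoneGap.not_monotoneLowerBoundsTransfer (h : MonotoneGap) :
    ¬ MonotoneLowerBoundsTransfer := by
  intro hT
  obtain ⟨⟨c, hc, N₀, hst⟩, hvp⟩ := h
  have hmap : (fun N => map NNReal.toRealHom (stPoly ℝ≥0 N)) = fun N => stPoly ℝ N := by
    funext N; exact map_stPoly _ N
  have hvpR : IsVPFamily (k := ℝ) fun N => stPoly ℝ N := hvp ℝ
  refine hT (fun N => Fin N × Option (Fin N)) (fun N => stPoly ℝ≥0 N) ?_ ?_ (hmap ▸ hvpR)
  · rw [hmap]; exact hvpR.1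
  · refine ⟨c, hc, N₀, fun N hN P hP => ?_⟩
    calc (2 : ℝ) ^ (c * N) ≤ (prodCount P : ℝ) := hst N hN P hP
      _ ≤ (P.size : ℝ) := by exact_mod_cast prodCount_le_size P

/-- The unconditional form over the two facts. [cite: JerrumSnir1982, §4.5 and §5.1] -/
theorem not_monotoneLowerBoundsTransfer (hst : JerrumSnir1982_spanningTree)
    (hvp : isVPFamily_stPoly) : ¬ MonotoneLowerBoundsTransfer :=
  MonotoneGap.not_monotoneLowerBoundsTransfer ⟨hst, hvp⟩

/-- **The `ε`-sensitive no-go.** For the `η > 0` of CDGM's second theorem the sensitive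
transfer at rate `2^{-ηn}` is false, `ST` being in `VP`.
[cite: ChattopadhyayDattaGhosalMukhopadhyay2022, §1 (second main theorem)] -/
theorem not_sensitiveTransfer (h : CDGM2022_sensitive) (hvp : isVPFamily_stPoly) :
    ∃ η : ℝ, 0 < η ∧ ¬ SensitiveTransfer η := by
  obtain ⟨η, hη, c, hc, N₀, hN⟩ := h
  exact ⟨η, hη, fun hT => hT ⟨c, hc, N₀, hN⟩ (hvp ℝ)⟩

/-- Monotonicity in the rate: the hypothesis at rate `η'` quantifies over more `ε` than at a
rate `η ≤ η'`, so the transfer at rate `η` implies the transfer at every `η' ≥ η`; equivalently a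
refutation at `η₀` refutes every rate `η ≤ η₀`. [folklore] -/
theorem SensitiveTransfer.mono {η η' : ℝ} (hle : η ≤ η') (h : SensitiveTransfer η) :
    SensitiveTransfer η' := by
  rintro ⟨c, hc, N₀, hN⟩
  refine h ⟨c, hc, N₀, fun N hN0 ε hε hε1 sub P hP => hN N hN0 ε (le_trans ?_ hε) hε1 sub P hP⟩
  apply Real.rpow_le_rpow_of_exponent_le (by norm_num)
  nlinarith [Nat.cast_nonneg (α := ℝ) N]

/-- Hence CDGM's theorem refutes the sensitive transfer at every sufficiently slow rate: there is
`η₀ > 0` with `¬ SensitiveTransfer η` for all `η ≤ η₀` (for `η ≤ 0` the `ε`-range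
`[2^{-ηN}, 1)` is empty, `SensitiveTransfer η` degenerates to `ST ∉ VP_ℝ`, and the statement is
just `isVPFamily_stPoly`; the interesting range is `0 < η ≤ η₀`).
[cite: ChattopadhyayDattaGhosalMukhopadhyay2022, §1 (second main theorem)] -/
theorem not_sensitiveTransfer_of_le (h : CDGM2022_sensitive) (hvp : isVPFamily_stPoly) :
    ∃ η₀ : ℝ, 0 < η₀ ∧ ∀ η : ℝ, η ≤ η₀ → ¬ SensitiveTransfer η := by
  obtain ⟨η₀, hη₀, hnot⟩ := not_sensitiveTransfer h hvp
  exact ⟨η₀, hη₀, fun η hle hT => hnot (hT.mono hle)⟩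

/-! ### Barrier audit (2026-08-16): the division transfer is NOT covered

The technique class of this entry is the division-FREE monotone model. Allowing division
(subtraction-free `{+,×,÷}` circuits; in the Hrubeš–Yehudayoff normal form, a monotone cofactor
`h ≠ 0` with `f · h = g`, `g` monotone, [HrubesYehudayoff2021, §6]) gives a larger model, hence
WEAKER lower-bound hypotheses and a weaker transfer principle, `DivisionLowerBoundsTransfer`,
which is implied by `MonotoneLowerBoundsTransfer` and is not refuted by `MonotoneGap`: the
spanning tree witness is division-easy ([FominGrigorievKoshevoy2014, Ex. 1.6, §7]; closed route
items `StDivisionEasy`, `SensitiveStDivisionEasy`, `SquareGridDimersDivisionEasy` of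
`Summits/ValiantsHypothesis/ValiantsHypothesis/Theses/DivisionGap.lean`), and no explicit monotone
polynomial is known to be division-hard ([HrubesYehudayoff2021, §6, Open Problem 3];
[CavalarBoremFabrisMukhopadhyaySrinivasanYehudayoff2025, §1.1]). -/

/-- The gate-free circuit reading off a constant `c` is a monotone computation of `C c` with no
gate at all: in Jerrum–Snir's model constants are free inputs, so a monotone cofactor `h = 1`
costs nothing. [cite: JerrumSnir1982, §2.2] -/
theorem isMonotoneComputation_ofConst {σ : Type v} (c : ℝ≥0) :
    IsMonotoneComputation (ArithCircuit.ofConst c : ArithCircuit ℝ≥0 σ) (C c) ∧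
      (ArithCircuit.ofConst c : ArithCircuit ℝ≥0 σ).size = 0 := by
  refine ⟨⟨?_, ?_, ArithCircuit.eval_ofConst c⟩, rfl⟩
  · intro g hg; simp [ArithCircuit.ofConst] at hg
  · intro g hg; simp [ArithCircuit.ofConst] at hg

/-- **Technique class NOT covered by this entry: subtraction-free lower bounds WITH DIVISION
transfer to `VP`.** For every p-family `(f_n)` over `ℝ≥0`: if for some `c > 0` and all large `n`,
every monotone cofactor `h ≠ 0` and every pair of monotone computations `P` of `f_n · h` and `Q`
of `h` have `P.size + Q.size ≥ 2^{cn}` — `f_n` is hard for monotone circuits WITH division in the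
normal form "If `f` can be computed by a monotone circuit with divisions of size `s` then we can
find non-zero `h` and `g` with monotone circuit size `O(s)` such that `fh = g`" — then
`(f_n) ∉ VP_ℝ`. Status in print: "Super-polynomial lower bounds on monotone circuits with
division computing a monotone polynomial `f` are not known" (HY21 §6; their Problem 2 and the
third problem of §9 ask for an explicit family meeting the hypothesis), and no `VP` family is
known to meet it (the witnesses of this entry do not: `ST` is division-easy, FGK Ex. 1.6), so this
technique class — unlike `MonotoneLowerBoundsTransfer` — is neither refuted nor usable today; it
is a TECHNIQUE CLASS recorded for barrier matching, not a vendored result, and a route that wants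
it takes it (or a sharper form, as the route `DivisionGap` of this summit does with its
`0/1`-coefficient, quasi-polynomial `ZeroOneTransfer`) as a crux. [cite: HrubesYehudayoff2021, §6 (Problem 2)] [cite: FominGrigorievKoshevoy2014, Ex. 1.4–1.6 and Rem. 1.5] -/
def DivisionLowerBoundsTransfer : Prop :=
  ∀ (σ : ℕ → Type) [∀ n, Fintype (σ n)] (f : ∀ n, MvPolynomial (σ n) ℝ≥0),
    IsPFamily (k := ℝ) (fun n => map NNReal.toRealHom (f n)) →
    (∃ c : ℝ, 0 < c ∧ ∃ n₀ : ℕ, ∀ n : ℕ, n₀ ≤ n → ∀ h : MvPolynomial (σ n) ℝ≥0, h ≠ 0 →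
        ∀ P Q : ArithCircuit ℝ≥0 (σ n),
          IsMonotoneComputation P (f n * h) → IsMonotoneComputation Q h →
            (2 : ℝ) ^ (c * n) ≤ ((P.size + Q.size : ℕ) : ℝ)) →
    ¬ IsVPFamily (k := ℝ) (fun n => map NNReal.toRealHom (f n))

/-- **The division transfer is the weaker principle.** Hardness against monotone circuits with
division (every cofactor `h ≠ 0`) contains, at `h = 1` with the gate-free computation of `1`,
hardness against plain monotone circuits; hence `MonotoneLowerBoundsTransfer` implies
`DivisionLowerBoundsTransfer`, and the refutation `MonotoneGap.not_monotoneLowerBoundsTransfer`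
of the former says nothing about the latter (a refutation of the division transfer would need a
`VP` family that is division-hard; the catalogued witnesses are division-easy).
[cite: HrubesYehudayoff2021, §6] [cite: FominGrigorievKoshevoy2014, Ex. 1.6] -/
theorem MonotoneLowerBoundsTransfer.divisionLowerBoundsTransfer
    (hT : MonotoneLowerBoundsTransfer) : DivisionLowerBoundsTransfer := by
  intro σ _ f hpf hhard
  refine hT σ f hpf ?_
  obtain ⟨c, hc, n₀, hn⟩ := hhard
  refine ⟨c, hc, n₀, fun n hn0 P hP => ?_⟩
  have hP' : IsMonotoneComputation P (f n * 1) := by rwa [mul_one]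
  have hQ := isMonotoneComputation_ofConst (σ := σ n) (1 : ℝ≥0)
  have hQ1 : IsMonotoneComputation (ArithCircuit.ofConst 1 : ArithCircuit ℝ≥0 (σ n)) 1 := by
    simpa using hQ.1
  have key := hn n hn0 1 one_ne_zero P (ArithCircuit.ofConst 1) hP' hQ1
  simpa [hQ.2] using key

/-- Contrapositive bookkeeping: refuting the division transfer would in particular refute the
division-free transfer, which `MonotoneGap` already does; the converse implication is exactly
what this entry does NOT provide. [cite: HrubesYehudayoff2021, §6 (Problem 2)] -/
theorem not_monotoneLowerBoundsTransfer_of_not_divisionLowerBoundsTransfer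
    (h : ¬ DivisionLowerBoundsTransfer) : ¬ MonotoneLowerBoundsTransfer :=
  fun hT => h hT.divisionLowerBoundsTransfer

end Literature.Barriers.ValiantsHypothesis
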